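import Literature.AlgebraicGeometry.HilbertScheme.HilbertSchemeOfPoints
import Mathlib.AlgebraicGeometry.Morphisms.Separated
import HarnessLib

/-!
# `Hilb^1_{X/B} = X`: a separated `B`-scheme represents its own Hilbert functor of one point

Layer `Literature/AlgebraicGeometry/HilbertScheme`; companion to `HilbertSchemeOfPoints.lean`
(`hilbertFunctorOfPoints`, `IsHilbertSchemeOfPoints`). The second sanity theorem for that
representability predicate (the first being `isHilbertSchemeOfPoints_zero`, `Hilb^0 = B`): for
`X → B` separated, the pair `(X, Δ_X)` — `X` with the diagonal `Δ_X ⊂ X ×_B X` as universal family —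
represents `Hilb^1_{X/B}` (`isHilbertSchemeOfPoints_one`). In words: a closed subscheme `Z ⊂ X_T`
finite locally free of degree `1` over `T` maps isomorphically to `T` (Mathlib
`Scheme.Hom.isIso_iff_finrank_eq`), hence is the graph of a unique `B`-morphism `g : T ⟶ X`, and
the graph of `g` is the pull-back of the diagonal along `X ×_B g`. For the Hilbert scheme of points
of a surface this is the familiar `S^[1] = S` (so that "`K3^[1]`-type" means "deformation of a K3
surface").

## Sources

* The Stacks Project, Tag 0B94 (the Hilbert functor of points; representability) and Section
  01KH "Separation axioms" (Definition 01KK: `f : X → S` is separated if `Δ_{X/S}` is a closed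
  immersion; Lemma 01KT: a section of a separated morphism is a closed immersion).
* A. Grothendieck, FGA no. 221, and N. Nitsure, arXiv:math/0504590, §1 (the functor of points
  formalism: `Hilb^1_{X/S} = X`, the case `Φ = 1` of the Hilbert scheme).

## Contents (all proved)

`isFiniteLocallyFreeOfRank_one_of_isIso` / `IsFiniteLocallyFreeOfRank.isIso` (degree `1` ⟺
isomorphism, Stacks 02KA via Mathlib); `diagonal X : X.left ⟶ (X ⊗ X).left` (Mathlib's
`pullback.diagonal X.hom` typed in the monoidal structure of `Over B`) with `diagonal_fst/snd`, a
closed immersion for `X → B` separated; `diagonalIdeal X` (its ideal, the universal family of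
`Hilb^1`); `graph g : T.left ⟶ (X ⊗ T).left` (the graph `(g, id)` of `g : T ⟶ X`) with
`graph_fst/snd`; `isPullback_graph` (**the graph is the pull-back of the diagonal along `X ×_B g`**),
`isClosedImmersion_graph`, `comap_diagonalIdeal` (`(X ×_B g)^* Δ_X = Γ_g` as ideals),
`diagonalIdeal_mem` (`Δ_X ∈ Hilb^1_{X/B}(X)`), and `isHilbertSchemeOfPoints_one`.
-/

noncomputable section

open CategoryTheory Limits MonoidalCategory AlgebraicGeometry

universe u

namespace Literature.AlgebraicGeometry.HilbertScheme

variable {B : Scheme.{u}}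

open SemiCartesianMonoidalCategory

/-! ### Degree `1` ⟺ isomorphism -/

/-- An isomorphism is finite locally free of rank `1`. [cite: StacksProject, Tag 02KA] -/
theorem isFiniteLocallyFreeOfRank_one_of_isIso {Z T : Scheme.{u}} (e : Z ⟶ T) [IsIso e] :
    IsFiniteLocallyFreeOfRank 1 e :=
  ⟨inferInstance, inferInstance, inferInstance, fun t ↦ by
    rw [Scheme.Hom.finrank_eq_one_of_isIso]; rfl⟩

/-- A morphism which is finite locally free of rank `1` is an isomorphism (Mathlib
`Scheme.Hom.isIso_iff_finrank_eq`). [cite: StacksProject, Tag 02KA] -/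
theorem IsFiniteLocallyFreeOfRank.isIso {Z T : Scheme.{u}} {p : Z ⟶ T}
    (h : IsFiniteLocallyFreeOfRank 1 p) : IsIso p := by
  haveI := h.isFinite
  haveI := h.flat
  haveI := h.locallyOfFinitePresentation
  rw [Scheme.Hom.isIso_iff_finrank_eq]
  funext t
  exact h.finrank_eq t

/-! ### The diagonal and graphs in `Over B` -/

variable (X : Over B)

/-- The diagonal `Δ : X → X ×_B X` (Mathlib's `pullback.diagonal X.hom`, typed in the cartesian
monoidal structure of `Over B`, `(X ⊗ X).left = pullback X.hom X.hom`).
[cite: StacksProject, Tag 01KH] -/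
def diagonal : X.left ⟶ (X ⊗ X).left :=
  pullback.diagonal X.hom

/-- `Δ ≫ pr₁ = id`. [folklore] -/
@[reassoc (attr := simp)]
theorem diagonal_fst : diagonal X ≫ (fst X X).left = 𝟙 X.left :=
  pullback.diagonal_fst X.hom

/-- `Δ ≫ pr₂ = id`. [folklore] -/
@[reassoc (attr := simp)]
theorem diagonal_snd : diagonal X ≫ (snd X X).left = 𝟙 X.left :=
  pullback.diagonal_snd X.hom

/-- For `X → B` separated the diagonal is a closed immersion (the definition of separatedness).
Deliberately an instance on this file's `diagonal`. [cite: StacksProject, Tag 01KK] -/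
instance isClosedImmersion_diagonal [IsSeparated X.hom] : IsClosedImmersion (diagonal X) :=
  IsSeparated.isClosedImmersion_diagonal

/-- **The ideal of the diagonal** `Δ_X ⊂ X ×_B X` — the universal family of `Hilb^1_{X/B}`.
[cite: StacksProject, Tag 0B94] -/
abbrev diagonalIdeal : (X ⊗ X).left.IdealSheafData :=
  (diagonal X).ker

variable {X}

/-- **The graph** `Γ_g = (g, id) : T → X ×_B T` of a `B`-morphism `g : T ⟶ X`, a section of the
projection to `T`. [folklore] -/
def graph {T : Over B} (g : T ⟶ X) : T.left ⟶ (X ⊗ T).left :=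
  pullback.lift g.left (𝟙 T.left) (by simp [Over.w])

/-- `Γ_g ≫ pr₁ = g`. [folklore] -/
@[reassoc (attr := simp)]
theorem graph_fst {T : Over B} (g : T ⟶ X) : graph g ≫ (fst X T).left = g.left :=
  pullback.lift_fst _ _ _

/-- `Γ_g ≫ pr₂ = id`. [folklore] -/
@[reassoc (attr := simp)]
theorem graph_snd {T : Over B} (g : T ⟶ X) : graph g ≫ (snd X T).left = 𝟙 T.left :=
  pullback.lift_snd _ _ _

/-- `(X ×_B g) ≫ pr₁ = pr₁` (Mathlib `Over.whiskerLeft_left_fst`, restated with both projections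
typed in `Over B`). [folklore] -/
theorem whiskerLeft_left_fst' {T T' : Over B} (g : T' ⟶ T) :
    (X ◁ g).left ≫ (fst X T).left = (fst X T').left :=
  Over.whiskerLeft_left_fst g

/-- `(X ×_B g) ≫ pr₂ = pr₂ ≫ g` (Mathlib `Over.whiskerLeft_left_snd`). [folklore] -/
theorem whiskerLeft_left_snd' {T T' : Over B} (g : T' ⟶ T) :
    (X ◁ g).left ≫ (snd X T).left = (snd X T').left ≫ g.left :=
  Over.whiskerLeft_left_snd g

/-- Morphisms into `X ×_B T` are determined by their two components. [folklore] -/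
theorem tensorObj_hom_ext {W : Scheme.{u}} {T : Over B} (a b : W ⟶ (X ⊗ T).left)
    (h₁ : a ≫ (fst X T).left = b ≫ (fst X T).left)
    (h₂ : a ≫ (snd X T).left = b ≫ (snd X T).left) : a = b :=
  pullback.hom_ext h₁ h₂

/-- **The graph of `g : T ⟶ X` is the pull-back of the diagonal `Δ_X` along `X ×_B g`**: the
square `Γ_g : T → X ×_B T`, `g : T → X`, `X ×_B g : X ×_B T → X ×_B X`, `Δ : X → X ×_B X` is
cartesian (elementwise: `{(x, t) | x = g t} ≅ T`). [folklore] -/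
theorem isPullback_graph {T : Over B} (g : T ⟶ X) :
    IsPullback (graph g) g.left (X ◁ g).left (diagonal X) := by
  have comm : graph g ≫ (X ◁ g).left = g.left ≫ diagonal X := by
    apply tensorObj_hom_ext
    · rw [Category.assoc, whiskerLeft_left_fst', graph_fst, Category.assoc, diagonal_fst,
        Category.comp_id]
    · rw [Category.assoc, whiskerLeft_left_snd', graph_snd_assoc, Category.assoc, diagonal_snd,
        Category.comp_id]
  refine IsPullback.of_isLimit' ⟨comm⟩ (PullbackCone.IsLimit.mk comm
    (fun s ↦ s.fst ≫ (snd X T).left) (fun s ↦ ?_) (fun s ↦ ?_) (fun s m hm _ ↦ ?_))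
  · have h1 : s.fst ≫ (fst X T).left = s.snd := by
      have := s.condition =≫ (fst X X).left
      rwa [Category.assoc, whiskerLeft_left_fst', Category.assoc, diagonal_fst,
        Category.comp_id] at this
    have h2 : s.fst ≫ (snd X T).left ≫ g.left = s.snd := by
      have := s.condition =≫ (snd X X).left
      rwa [Category.assoc, whiskerLeft_left_snd', Category.assoc, diagonal_snd,
        Category.comp_id] at this
    apply tensorObj_hom_ext
    · rw [Category.assoc, graph_fst, Category.assoc, h2, h1]
    · rw [Category.assoc, graph_snd, Category.comp_id]
  · have h2 : s.fst ≫ (snd X T).left ≫ g.left = s.snd := by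
      have := s.condition =≫ (snd X X).left
      rwa [Category.assoc, whiskerLeft_left_snd', Category.assoc, diagonal_snd,
        Category.comp_id] at this
    rw [Category.assoc, h2]
  · rw [← hm, Category.assoc, graph_snd, Category.comp_id]

/-- The graph of a morphism to a separated `X` is a closed immersion (base change of the
diagonal; Stacks 01KT: a section of a separated morphism is a closed immersion).
[cite: StacksProject, Tag 01KT] -/
instance isClosedImmersion_graph [IsSeparated X.hom] {T : Over B} (g : T ⟶ X) :
    IsClosedImmersion (graph g) :=
  MorphismProperty.of_isPullback (isPullback_graph g).flip inferInstance

/-- **`(X ×_B g)^* Δ_X = Γ_g`** as ideal sheaves of `X ×_B T`: pulling the diagonal ideal back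
along `X ×_B g` gives the ideal of the graph of `g`. [folklore] -/
theorem comap_diagonalIdeal [IsSeparated X.hom] {T : Over B} (g : T ⟶ X) :
    (diagonalIdeal X).comap (X ◁ g).left = (graph g).ker := by
  rw [← Scheme.IdealSheafData.ker_fst_of_isClosedImmersion,
    ← (isPullback_graph g).isoPullback_hom_fst, Scheme.Hom.ker_comp_of_isIso]

/-! ### `Hilb^1_{X/B} = X` -/

/-- The diagonal is an `X`-point of `Hilb^1_{X/B}`: `Δ_X ≅ X → X` is an isomorphism, hence finite
locally free of degree `1`. [cite: StacksProject, Tag 0B94] -/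
theorem diagonalIdeal_mem [IsSeparated X.hom] :
    diagonalIdeal X ∈ hilbertFunctorOfPoints 1 X X := by
  rw [mem_hilbertFunctorOfPoints_iff]
  have h : (diagonal X).toImage ≫ ((diagonalIdeal X).subschemeι ≫ (snd X X).left) = 𝟙 _ := by
    rw [← Category.assoc]
    change ((diagonal X).toImage ≫ (diagonal X).imageι) ≫ (snd X X).left = 𝟙 _
    rw [Scheme.Hom.toImage_imageι, diagonal_snd]
  haveI : IsIso ((diagonal X).toImage ≫ ((diagonalIdeal X).subschemeι ≫ (snd X X).left)) := by
    rw [h]; infer_instance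
  haveI : IsIso ((diagonalIdeal X).subschemeι ≫ (snd X X).left) :=
    IsIso.of_isIso_comp_left (diagonal X).toImage _
  exact isFiniteLocallyFreeOfRank_one_of_isIso _

/-- **`Hilb^1_{X/B} = X`.** For `X → B` separated, `X` with the diagonal `Δ_X ⊂ X ×_B X` as
universal family represents the Hilbert functor of `1` point: a closed subscheme `Z ⊂ X_T` of
degree `1` over `T` projects isomorphically onto `T`, so it is the graph of the `B`-morphism
`g = pr₁ ∘ (Z → T)⁻¹ : T ⟶ X`, i.e. `(X ×_B g)^* Δ_X = Z`; and `g` is unique because a graph with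
the same ideal as `Z` factors `Z ↪ X_T` (universal property of closed immersions, Mathlib
`IsClosedImmersion.lift`). [cite: StacksProject, Tag 0B94] [cite: Nitsure2005, §1] -/
theorem isHilbertSchemeOfPoints_one [IsSeparated X.hom] :
    IsHilbertSchemeOfPoints 1 X X (diagonalIdeal X) where
  mem := diagonalIdeal_mem
  existsUnique_hom T I hI := by
    -- the structure map `Z_I → T` is an isomorphism
    set p : I.subscheme ⟶ T.left := I.subschemeι ≫ (snd X T).left with hp
    haveI : IsIso p := IsFiniteLocallyFreeOfRank.isIso hI
    -- the classifying map `g = pr₁ ∘ p⁻¹`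
    let g : T ⟶ X := Over.homMk (inv p ≫ I.subschemeι ≫ (fst X T).left) (by
      have h1 : (fst X T).left ≫ X.hom = (snd X T).left ≫ T.hom := pullback.condition
      rw [Category.assoc, Category.assoc, h1, ← Category.assoc I.subschemeι, ← hp,
        IsIso.inv_hom_id_assoc])
    have hg : g.left = inv p ≫ I.subschemeι ≫ (fst X T).left := rfl
    -- `Z_I ↪ X_T` is `p` followed by the graph of `g`
    have hι : I.subschemeι = p ≫ graph g := by
      apply tensorObj_hom_ext
      · rw [Category.assoc, graph_fst, hg, IsIso.hom_inv_id_assoc]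
      · rw [Category.assoc, graph_snd, Category.comp_id, hp]
    have hgI : (diagonalIdeal X).comap (X ◁ g).left = I := by
      rw [comap_diagonalIdeal, ← Scheme.Hom.ker_comp_of_isIso p (graph g), ← hι,
        Scheme.IdealSheafData.ker_subschemeι]
    refine ⟨g, hgI, fun g' hg' ↦ ?_⟩
    -- uniqueness: the graph of `g'` has the same ideal as `Z_I`, so `Z_I` factors through it
    have hg' : (diagonalIdeal X).comap (X ◁ g').left = I := hg'
    rw [comap_diagonalIdeal] at hg'
    have hker : (graph g').ker ≤ I.subschemeι.ker := by
      rw [Scheme.IdealSheafData.ker_subschemeι, hg']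
    have he : IsClosedImmersion.lift (graph g') I.subschemeι hker = p := by
      have h2 := IsClosedImmersion.lift_fac (graph g') I.subschemeι hker =≫ (snd X T).left
      rw [Category.assoc, graph_snd, Category.comp_id] at h2
      exact h2.trans hp.symm
    ext
    rw [hg, IsIso.eq_inv_comp, ← he,
      ← IsClosedImmersion.lift_fac_assoc (graph g') I.subschemeι hker, graph_fst]

end Literature.AlgebraicGeometry.HilbertScheme
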